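import Literature.Probability.Percolation.KhSThreeDisorderCrossing
import HarnessLib

/-!
# Khristoforov–Smirnov eq. (4), percolation side, at EVERY mid-edge of the arc `A₀` («KhS-EQ4-PERC-K3-BONDS»)

The parent file `KhSThreeDisorderCrossing.lean` proves Khristoforov–Smirnov's Lemma 2 for the disorders `(y₀, z, y₁, y₂)` and the
percolation side of eq. (4) at `k = 3` for a boundary mid-edge `z` of the arc `A₀` READ AT A FACE `v` WITH THREE `H_G`-SIDES
(`hv : AllSides D v`, the standing hypothesis of Lemma 4). The printed statement has no such restriction: `z` is any mid-edge of the
boundary arc. The hypothesis is idle, and this file removes it. At a site of `G` with three consecutive outer neighbours the middle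
mid-edge has two faces with two outer vertices each («tip» mid-edges), and next to the marks `v₀`, `v₁` a face of `z` may be the corner
face `y₀` / `y₁` itself; the parent file is silent there, this file is not.

What `AllSides` was used for, and how it is replaced:
* the count `#W(…, z) = 2 ^ #G` over both halves of the subdivided edge (`card_TXb_add_card_TXb`): re-proved for an arbitrary
  `H_G`-bond as `card_TXb_add_card_TXb_of_mem` (odd-set `corners Δ {v}`, which also covers a corner face `v`);
* «a corner endpoint is isolated» (`not_reachable_of_corner_end`): re-proved from `side v i ∈ H_G` alone
  (`not_reachable_of_corner_end_of_mem`);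
* «on `A₀` the strand from `z` never ends at `y₂`» (`not_reachable_yc_two`, proved on the loop side by colour propagation): re-proved
  here on the PERCOLATION side from the parent file's bond invariants — a strand of `Φ(σ)` arriving at `y₂` through `predDart 2` (outer
  cell on `A₁`, blue) violates the blue invariant unless `σ` has the blue crossing, and its yellow `G`-endpoint `v₂ ∈ A₂` is
  yellow-joined to `∂_{z y₁}`, a yellow crossing; through `markDart 2` symmetrically; the two crossings do not coexist
  (`not_blueCross_of_yellowCross`). See `not_reachable_yc_two_Phi`.

Main statements (hypotheses: `(g, o)` a boundary dart of stretch index `0`, `side v i = s(g, o)`; NO hypothesis on the face `v`):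
`inClassX_one_iff_blueCross'`, `inClassX_zero_iff_yellowCross'` (Lemma 2), `classCount_one_eq_card_blueCross'`,
`classCount_zero_eq_card_yellowCross'`, `classCount_two_eq_zero'`, `card_filter_blueCross_add_card_filter_yellowCross`
(dichotomy of colourings), ★ `hobs_one_eq_prob'`, `hobs_zero_eq_prob'`, `hobs_two_eq_zero'`, `hobs_zero_add_hobs_one'`,
`fobs_eq_crossingProbs'`, `hobs_zero_eq_prob_open'`, `fobs_eq_openCrossingProbs'` (eq. (4) as printed, every mid-edge of `A₀`).

## References
* M. Khristoforov, S. Smirnov, *Percolation and O(1) loop model*, arXiv:2111.15612 (2021): §1.2 Lemma 2 and its proof (arXiv v1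
  p. 3), §2 Definition 3 (p. 4), eq. (4) (p. 5).
* B. Bollobás, O. Riordan, *Percolation*, CUP 2006, Ch. 7 Lemma 5 (p. 193) — «but not both».
-/

open Finset

namespace Literature.Probability.Percolation.MarkedLoops

open Literature.Probability.Percolation Literature.Probability.LatticeModels
open Literature.Probability.Percolation.FivePoint (Inc inc_mk_iff side inc_side side_injective xiDeg XiLinked tau
  hexFaceVertices_eq_triple)
open Literature.Probability.Percolation.FivePoint.N5 (sideGraph side_oppFace_oppIdx l1_xiDeg_eq xiLinked_iff_reachable h1_ne_oppFace
  ht3_pair_eq_side xorDeg_holds l1_odd_xiDeg_singleton_iff)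
open TriMarkedDomain

/-! ### auxiliary arithmetic on `Fin 3` -/

section Aux

/-- Auxiliary. [folklore] -/
private theorem fin3_cases_b (v j : Fin 3) : j = v ∨ j = v + 1 ∨ j = v + 2 := by revert v j; decide

/-- Auxiliary. [folklore] -/
private theorem fin3_add_one_add_two_b (j : Fin 3) : j + 1 + 2 = j := by rw [add_assoc]; exact add_eq_left.2 (by decide)

/-- Auxiliary. [folklore] -/
private theorem fin3_add_one_add_one_b (j : Fin 3) : j + 1 + 1 = j + 2 := by rw [add_assoc]; rfl

/-- Auxiliary. [folklore] -/
private theorem fin3_ne_add_one_b (j : Fin 3) : j ≠ j + 1 := by revert j; decide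

/-- Auxiliary. [folklore] -/
private theorem fin3_ne_add_two_b (j : Fin 3) : j ≠ j + 2 := by revert j; decide

/-- Auxiliary. [folklore] -/
private theorem fin3_add_two_ne_add_one_b (j : Fin 3) : j + 2 ≠ j + 1 := by revert j; decide

/-- the three sides listed from `j`. [folklore] -/
private theorem sides_from_b (F : HexVertex) (j : Fin 3) :
    side F (j + 2) = s(faceVertex F j, faceVertex F (j + 1)) ∧ side F (j + 1) = s(faceVertex F (j + 2), faceVertex F j) ∧
      side F j = s(faceVertex F (j + 1), faceVertex F (j + 2)) := by
  unfold side
  rw [fin3_add_two_add_one, fin3_add_two_add_two, fin3_add_one_add_one_b, fin3_add_one_add_two_b]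
  exact ⟨rfl, rfl, rfl⟩

/-- erasing a member is the symmetric difference with the singleton. [folklore] -/
private theorem erase_eq_symmDiff_b {b : Sym2 (Site 2)} {ξ : Finset (Sym2 (Site 2))} (h : b ∈ ξ) : ξ.erase b = symmDiff ξ {b} := by
  ext e
  rw [Finset.mem_erase, Finset.mem_symmDiff, Finset.mem_singleton]
  constructor
  · rintro ⟨hne, he⟩; exact Or.inl ⟨he, hne⟩
  · rintro (⟨he, hne⟩ | ⟨rfl, hn⟩)
    · exact ⟨hne, he⟩
    · exact absurd h hn

/-- inserting a non-member is the symmetric difference with the singleton. [folklore] -/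
private theorem insert_eq_symmDiff_b {b : Sym2 (Site 2)} {ξ : Finset (Sym2 (Site 2))} (h : b ∉ ξ) : insert b ξ = symmDiff ξ {b} := by
  ext e
  rw [Finset.mem_insert, Finset.mem_symmDiff, Finset.mem_singleton]
  constructor
  · rintro (rfl | he)
    · exact Or.inr ⟨rfl, h⟩
    · exact Or.inl ⟨he, fun e' => h (e' ▸ he)⟩
  · rintro (⟨he, -⟩ | ⟨rfl, -⟩)
    · exact Or.inr he
    · exact Or.inl rfl

end Aux

/-! ### the count over both halves and the isolated corner endpoint, for an arbitrary `H_G`-bond (any number of marks) -/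

section Count

variable {nm : ℕ} (D : TriMarkedDomain nm)

/-- ★ **`#W_Ω(u₁,…,u_k,z) = 2 ^ #G` at ANY edge of `H_G`** (`k` odd), both halves of the subdivided edge together:
`#TXb D v i v + #TXb D v i (oppFace v i) = 2 ^ #G` whenever `side v i ∈ H_G` — the face `v` may be a corner face (then its half
has the even odd-set `corners ∖ {v}`). [cite: KhristoforovSmirnov2021, §1.2 (arXiv v1 p. 2: «exactly 2^{#Faces(Ω)} loop configurations with given disorders») and §2 Definition 3 (p. 4)] -/
theorem card_TXb_add_card_TXb_of_mem (hodd : Odd nm) {v : HexVertex} {i : Fin 3} (hb : side v i ∈ hBonds D) :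
    #(TXb D v i v) + #(TXb D v i (oppFace v i)) = 2 ^ #D.verts := by
  classical
  have hvT : v ∈ triFacesTouching D.verts := mem_touching_of_side_mem D hb
  have hvo : v ≠ oppFace v i := h1_ne_oppFace v i
  obtain ⟨O, hO⟩ : ∃ O : Finset HexVertex, O = symmDiff (corners D) {v} := ⟨_, rfl⟩
  have hOsub : O ⊆ triFacesTouching D.verts := by
    intro F hF
    rw [hO, Finset.mem_symmDiff, Finset.mem_singleton] at hF
    rcases hF with ⟨hF, -⟩ | ⟨rfl, -⟩
    · obtain ⟨a, rfl⟩ := (mem_corners D).1 hF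
      exact yc_mem_touching D a
    · exact hvT
  have hcardc : #(corners D) = nm := by
    unfold corners
    rw [Finset.card_image_of_injective _ (yc_injective D), Finset.card_univ, Fintype.card_fin]
  have hOeven : Even #O := by
    by_cases hvc : v ∈ corners D
    · have hO' : O = (corners D).erase v := by
        rw [hO]; ext F
        rw [Finset.mem_symmDiff, Finset.mem_singleton, Finset.mem_erase]
        constructor
        · rintro (⟨h, hn⟩ | ⟨rfl, hn⟩)
          · exact ⟨hn, h⟩
          · exact absurd hvc hn
        · rintro ⟨hn, h⟩; exact Or.inl ⟨h, hn⟩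
      rw [hO', Finset.card_erase_of_mem hvc, hcardc]
      obtain ⟨k, hk⟩ := hodd
      exact ⟨k, by omega⟩
    · have hO' : O = insert v (corners D) := by
        rw [hO]; ext F
        rw [Finset.mem_symmDiff, Finset.mem_singleton, Finset.mem_insert]
        constructor
        · rintro (⟨h, -⟩ | ⟨rfl, -⟩)
          · exact Or.inr h
          · exact Or.inl rfl
        · rintro (rfl | h)
          · exact Or.inr ⟨rfl, hvc⟩
          · exact Or.inl ⟨h, fun e => hvc (e ▸ h)⟩
      rw [hO', Finset.card_insert_of_notMem hvc, hcardc]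
      exact hodd.add_one
  have hcount := card_filter_parity_eq D hOsub hOeven
  have hPv : ∀ F, F ∈ symmDiff (corners D) ({v} : Finset HexVertex) ↔ F ∈ O := fun F => by rw [hO]
  have hPo : ∀ F, F ∈ symmDiff (corners D) ({oppFace v i} : Finset HexVertex) ↔ ¬ (F ∈ O ↔ (F = v ∨ F = oppFace v i)) := by
    intro F
    rw [hO, Finset.mem_symmDiff, Finset.mem_symmDiff, Finset.mem_singleton, Finset.mem_singleton]
    by_cases h1 : F = v
    · have h2 : F ≠ oppFace v i := fun h2 => hvo (h1.symm.trans h2)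
      tauto
    · by_cases h2 : F = oppFace v i
      · tauto
      · tauto
  set S := (hBonds D).powerset.filter fun ξ => ∀ F ∈ triFacesTouching D.verts, (Odd (xiDeg ξ F) ↔ F ∈ O) with hS
  have htoggle : ∀ (B : Finset (Sym2 (Site 2))) (F : HexVertex), F ∈ triFacesTouching D.verts →
      (Odd (xiDeg (symmDiff B {side v i}) F) ↔ ¬ (Odd (xiDeg B F) ↔ (F = v ∨ F = oppFace v i))) := by
    intro B F hF
    rw [xorDeg_holds B {side v i} F, odd_xiDeg_side_iff D hb hF]
  -- the half avoiding the bond is the `v`-half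
  have hS0 : S.filter (fun ξ => side v i ∉ ξ) = TXb D v i v := by
    ext ξ
    rw [Finset.mem_filter, hS, Finset.mem_filter, Finset.mem_powerset, mem_TXb_iff]
    unfold ParityIs
    constructor
    · rintro ⟨⟨hsub, hpar⟩, hb'⟩
      refine ⟨fun e he' => Finset.mem_erase.2 ⟨fun h => hb' (h ▸ he'), hsub he'⟩, fun F hF => ?_⟩
      rw [hpar F hF, hPv]
    · rintro ⟨hsub, hpar⟩
      refine ⟨⟨fun e he' => (Finset.mem_erase.1 (hsub he')).2, fun F hF => ?_⟩, fun hb' => (Finset.mem_erase.1 (hsub hb')).1 rfl⟩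
      rw [hpar F hF, hPv]
  -- the half using the bond is, after erasing it, the `oppFace v i`-half
  have hS1 : #(S.filter (fun ξ => side v i ∈ ξ)) = #(TXb D v i (oppFace v i)) := by
    refine Finset.card_bij (fun ξ _ => ξ.erase (side v i)) (fun ξ hξ => ?_) (fun ξ hξ ξ' hξ' h => ?_) (fun ζ hζ => ?_)
    · obtain ⟨hξS, hb'⟩ := Finset.mem_filter.1 hξ
      rw [hS, Finset.mem_filter, Finset.mem_powerset] at hξS
      obtain ⟨hsub, hpar⟩ := hξS
      rw [mem_TXb_iff]
      refine ⟨Finset.erase_subset_erase _ hsub, fun F hF => ?_⟩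
      rw [erase_eq_symmDiff_b hb', htoggle ξ F hF, hpar F hF, hPo]
    · have hb1 : side v i ∈ ξ := (Finset.mem_filter.1 hξ).2
      have hb2 : side v i ∈ ξ' := (Finset.mem_filter.1 hξ').2
      rw [← Finset.insert_erase hb1, ← Finset.insert_erase hb2, h]
    · obtain ⟨hsub, hpar⟩ := (mem_TXb_iff v i (oppFace v i) ζ).1 hζ
      have hb_not : side v i ∉ ζ := fun h => (Finset.mem_erase.1 (hsub h)).1 rfl
      refine ⟨insert (side v i) ζ, Finset.mem_filter.2 ⟨?_, Finset.mem_insert_self _ _⟩, Finset.erase_insert hb_not⟩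
      rw [hS, Finset.mem_filter, Finset.mem_powerset]
      refine ⟨Finset.insert_subset hb fun e he' => (Finset.mem_erase.1 (hsub he')).2, fun F hF => ?_⟩
      rw [insert_eq_symmDiff_b hb_not, htoggle ζ F hF, hpar F hF, hPo]
      tauto
  rw [← hS0, ← hS1, add_comm, Finset.card_filter_add_card_filter_not]
  exact hcount

variable {D}

/-- **a corner endpoint is isolated** at any `H_G`-bond: if the odd endpoint `s ∈ {v, oppFace v i}` of the XOR space at `side v i ∈ H_G`
is a corner face (then `z` is next to a mark and `s` is even), no side of `s` lies in the configuration, so the strand from `s` reaches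
nothing else. [cite: KhristoforovSmirnov2021, §2 Definition 3 (p. 4)] -/
theorem not_reachable_of_corner_end_of_mem {v : HexVertex} {i : Fin 3} (hb : side v i ∈ hBonds D) {s : HexVertex}
    (hs : s ∈ ({v, oppFace v i} : Finset HexVertex)) (hsc : s ∈ corners D) {ξ : Finset (Sym2 (Site 2))} (hξ : ξ ∈ TXb D v i s)
    {Y : HexVertex} (hY : Y ≠ s) : ¬ (sideGraph ξ).Reachable s Y := by
  classical
  rw [mem_TXb_iff] at hξ
  obtain ⟨hsub, hpar⟩ := hξ
  have hξh : ξ ⊆ hBonds D := fun b hb' => Finset.mem_of_mem_erase (hsub hb')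
  obtain ⟨a, rfl⟩ := (mem_corners D).1 hsc
  obtain ⟨j₀, hj₀⟩ : ∃ j : Fin 3, side (yc D a) j = side v i := by
    rw [Finset.mem_insert, Finset.mem_singleton] at hs
    rcases hs with e | e
    · exact ⟨i, by rw [e]⟩
    · exact ⟨oppIdx v i, by rw [e, side_oppFace_oppIdx]⟩
  obtain ⟨w, hw⟩ := exists_side_not_mem_hBonds_of_corner D (yc_spec D a)
  have hjw : j₀ ≠ w := fun e => hw (by rw [← e, hj₀]; exact hb)
  have hfilter : ((Finset.univ : Finset (Fin 3)).filter fun j => side (yc D a) j ∈ ξ) ⊆ (Finset.univ.erase j₀).erase w := by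
    intro j hj
    rw [Finset.mem_filter] at hj
    rw [Finset.mem_erase, Finset.mem_erase]
    refine ⟨fun e => hw (e ▸ hξh hj.2), fun e => ?_, Finset.mem_univ _⟩
    rw [e, hj₀] at hj
    exact (Finset.mem_erase.1 (hsub hj.2)).1 rfl
  have hcard : #((Finset.univ.erase j₀).erase w) = 1 := by
    rw [Finset.card_erase_of_mem (by rw [Finset.mem_erase]; exact ⟨hjw.symm, Finset.mem_univ _⟩),
      Finset.card_erase_of_mem (Finset.mem_univ _), Finset.card_univ, Fintype.card_fin]
  have hle1 : xiDeg ξ (yc D a) ≤ 1 := by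
    rw [l1_xiDeg_eq]; exact (Finset.card_le_card hfilter).trans hcard.le
  have heven : ¬ Odd (xiDeg ξ (yc D a)) := fun h => by
    have := (hpar _ (yc_mem_touching D a)).1 h
    rw [Finset.mem_symmDiff, Finset.mem_singleton] at this
    rcases this with ⟨-, hne⟩ | ⟨-, hnc⟩
    · exact hne rfl
    · exact hnc hsc
  have hzero : xiDeg ξ (yc D a) = 0 := by
    rcases Nat.le_one_iff_eq_zero_or_eq_one.1 hle1 with h | h
    · exact h
    · exact absurd (h ▸ odd_one) heven
  intro hR
  rw [SimpleGraph.reachable_iff_reflTransGen] at hR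
  rcases Relation.ReflTransGen.cases_head hR with e | ⟨c, hadj, -⟩
  · exact hY e.symm
  · obtain ⟨j, -, hj⟩ := hadj
    rw [l1_xiDeg_eq, Finset.card_eq_zero, Finset.filter_eq_empty_iff] at hzero
    exact hzero (Finset.mem_univ j) hj

end Count

/-! ### the three-mark boundary theory without `AllSides` -/

section Three

variable {D : TriMarkedDomain 3}
variable {g o : Site 2} (hg : g ∈ D.verts) (ho : o ∉ D.verts) (hadj : triGraph.Adj g o) (hst : D.stretchIdx₃ (D.dpos (g, o)) = 0)

/-- the bond of a boundary dart is an edge of `H_G`. [cite: KhristoforovSmirnov2021, §1.2 (loop configurations, arXiv v1 pp. 2–3)] -/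
theorem side_mem_hBonds_of_eq (hg : g ∈ D.verts) (hadj : triGraph.Adj g o) {v : HexVertex} {i : Fin 3} (he : side v i = s(g, o)) :
    side v i ∈ hBonds D := by
  rw [he]; exact mem_hBonds D hadj (Or.inl hg)

include hg ho hadj in
/-- the odd endpoint `sOf σ` is one of the two faces of the bond of `z`, for ANY face `v` of that bond. [cite: KhristoforovSmirnov2021, §1.2 Lemma 2, proof (arXiv v1 p. 3)] -/
theorem sOf_mem_pair' {v : HexVertex} {i : Fin 3} (he : side v i = s(g, o)) (T : Finset (Site 2)) :
    sOf D g o T ∈ ({v, oppFace v i} : Finset HexVertex) := by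
  have hb : side v i ∈ hBonds D := side_mem_hBonds_of_eq hg hadj he
  have hvT : v ∈ triFacesTouching D.verts := mem_touching_of_side_mem D hb
  have hoT : oppFace v i ∈ triFacesTouching D.verts :=
    mem_touching_of_side_mem D (j := oppIdx v i) (by rw [side_oppFace_oppIdx]; exact hb)
  have hsT : sOf D g o T ∈ triFacesTouching D.verts :=
    mem_triFacesTouching.2 ⟨g, hg, (inc_mk_iff.1 (inc_sOf hg ho hadj T)).1⟩
  have iv : Inc v (side v i) := inc_side v i
  have io : Inc (oppFace v i) (side v i) := by rw [← side_oppFace_oppIdx]; exact inc_side _ _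
  have is : Inc (sOf D g o T) (side v i) := by rw [he]; exact inc_sOf hg ho hadj T
  rw [Finset.mem_insert, Finset.mem_singleton]
  exact eq_or_eq_of_inc_three D hb hvT hoT hsT iv io is (h1_ne_oppFace v i)

include hg ho hadj hst in
/-- ★ **surjectivity of `Φ` onto both halves, at any mid-edge of `A₀`**: the images of the `2 ^ #G` colourings fill
`TXb D v i v ∪ TXb D v i (oppFace v i)` (injectivity + `card_TXb_add_card_TXb_of_mem`). [cite: KhristoforovSmirnov2021, §1.2 (arXiv v1 p. 2) and Lemma 2, proof (p. 3): «This map is a bijection»] -/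
theorem Phi_image_eq' {v : HexVertex} {i : Fin 3} (he : side v i = s(g, o)) :
    (D.verts.powerset).image (Phi D g o) = TXb D v i v ∪ TXb D v i (oppFace v i) := by
  classical
  apply Finset.eq_of_subset_of_card_le
  · intro ξ hξ
    obtain ⟨T, -, rfl⟩ := Finset.mem_image.1 hξ
    have hm := Phi_mem_TXb hg ho hadj hst he T
    have hs := sOf_mem_pair' hg ho hadj he T
    rw [Finset.mem_insert, Finset.mem_singleton] at hs
    rw [Finset.mem_union]
    rcases hs with e | e
    · exact Or.inl (e ▸ hm)
    · exact Or.inr (e ▸ hm)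
  · rw [Finset.card_image_of_injOn (Phi_injOn hg ho hadj hst he), Finset.card_powerset]
    calc #(TXb D v i v ∪ TXb D v i (oppFace v i)) ≤ #(TXb D v i v) + #(TXb D v i (oppFace v i)) := Finset.card_union_le _ _
      _ = 2 ^ #D.verts := card_TXb_add_card_TXb_of_mem D (by decide) (side_mem_hBonds_of_eq hg hadj he)

include hg ho hadj hst in
/-- every configuration of a half is the image of a colouring with the matching odd endpoint (any mid-edge of `A₀`).
[cite: KhristoforovSmirnov2021, §1.2 Lemma 2, proof (arXiv v1 p. 3)] -/
theorem exists_eq_Phi' {v : HexVertex} {i : Fin 3} (he : side v i = s(g, o)) {s : HexVertex}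
    (hs : s ∈ ({v, oppFace v i} : Finset HexVertex)) {ξ : Finset (Sym2 (Site 2))} (hξ : ξ ∈ TXb D v i s) :
    ∃ T : Finset (Site 2), T ⊆ D.verts ∧ Phi D g o T = ξ ∧ sOf D g o T = s := by
  classical
  have hmem : ξ ∈ (D.verts.powerset).image (Phi D g o) := by
    rw [Phi_image_eq' hg ho hadj hst he, Finset.mem_union]
    rw [Finset.mem_insert, Finset.mem_singleton] at hs
    rcases hs with rfl | rfl
    · exact Or.inl hξ
    · exact Or.inr hξ
  obtain ⟨T, hT, rfl⟩ := Finset.mem_image.1 hmem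
  refine ⟨T, Finset.mem_powerset.1 hT, rfl, ?_⟩
  by_contra hne
  exact not_mem_TXb_of_mem_TXb (sOf_touching hg ho hadj T) hne (Phi_mem_TXb hg ho hadj hst he T) hξ

/-! ### propagation of the bond invariants (verbatim from the parent file, `AllSides` removed) -/

include hg ho hadj hst

/-- **the propagation step between faces**: across a side in `Φ(σ)` the face invariant passes to the next face.
[cite: KhristoforovSmirnov2021, §1.2 Lemma 2, proof (arXiv v1 p. 3)] -/
theorem pface_step' {v : HexVertex} {i : Fin 3} (he : side v i = s(g, o)) (T : Finset (Site 2)) {F F' : HexVertex}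
    (hP : PFace D g o T F) (hFF' : (sideGraph (Phi D g o T)).Adj F F') : PFace D g o T F' := by
  classical
  by_cases hgoal : BlueCross D g o T
  · exact Or.inl hgoal
  by_cases hFs : F' = sOf D g o T
  · rw [hFs]; exact pface_sOf hg ho hadj hst T
  obtain ⟨j, rfl, hj⟩ := hFF'
  set ξ := Phi D g o T with hξdef
  have hξT := Phi_mem_TXb hg ho hadj hst he T
  have hsub : ξ ⊆ hBonds D := fun b hb => phiZ_subset _ T hb
  set k := oppIdx F j with hk
  set F' := oppFace F j with hF'def
  -- the shared side, seen from F'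
  have hshared : side F' k = side F j := side_oppFace_oppIdx F j
  have hjk' : side F' k ∈ ξ := by rw [hshared]; exact hj
  have hokk : OKb D g o T (faceVertex F' (k + 1)) (faceVertex F' (k + 2)) := by
    have := okb_of_pface hP hgoal hj (rfl : side F j = s(faceVertex F (j + 1), faceVertex F (j + 2)))
    rw [hF'def, hk, faceVertex_oppFace_succ, faceVertex_oppFace_succ_succ]
    exact okb_symm this
  right
  intro j' hj'
  by_cases hjk : j' = k
  · rw [hjk]; exact hokk
  -- two distinct sides of F' in ξ: F' is even, hence not a corner (being ≠ s)
  have hF't : F' ∈ triFacesTouching D.verts := mem_touching_of_side_mem D (hsub hj')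
  have hs := sOf_mem_pair' hg ho hadj he T
  have hdeg := xiDeg_le_two_of_mem_TXb D i hs hξT F'
  have hge : 2 ≤ xiDeg ξ F' := by
    rw [l1_xiDeg_eq]
    have hsub2 : ({k, j'} : Finset (Fin 3)) ⊆ ((Finset.univ : Finset (Fin 3)).filter fun i => side F' i ∈ ξ) := by
      intro x hx
      rw [Finset.mem_insert, Finset.mem_singleton] at hx
      rw [Finset.mem_filter]
      rcases hx with rfl | rfl
      · exact ⟨Finset.mem_univ _, hjk'⟩
      · exact ⟨Finset.mem_univ _, hj'⟩
    have hc : #({k, j'} : Finset (Fin 3)) = 2 := Finset.card_pair (Ne.symm hjk)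
    calc 2 = #({k, j'} : Finset (Fin 3)) := hc.symm
      _ ≤ _ := Finset.card_le_card hsub2
  have h2 : xiDeg ξ F' = 2 := le_antisymm hdeg hge
  have heven : ¬ Odd (xiDeg ξ F') := by rw [h2]; decide
  have hFc : F' ∉ corners D := by
    intro hc
    have hξT' := hξT
    rw [mem_TXb_iff] at hξT'
    apply heven
    apply (hξT'.2 _ hF't).2
    rw [Finset.mem_symmDiff, Finset.mem_singleton]; exact Or.inl ⟨hc, hFs⟩
  -- vertices of F' from k
  obtain ⟨s2, s1, s0⟩ := sides_from_b F' k
  have hx0 := faceVertex_mem F' k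
  have hx1 := faceVertex_mem F' (k + 1)
  have hx2 := faceVertex_mem F' (k + 2)
  have n01 : faceVertex F' k ≠ faceVertex F' (k + 1) := fun e => fin3_ne_add_one_b k (faceVertex_injective _ e)
  have n02 : faceVertex F' k ≠ faceVertex F' (k + 2) := fun e => fin3_ne_add_two_b k (faceVertex_injective _ e)
  have n12 : faceVertex F' (k + 1) ≠ faceVertex F' (k + 2) :=
    fun e => fin3_add_two_ne_add_one_b k (faceVertex_injective _ e).symm
  have hab : s(faceVertex F' (k + 1), faceVertex F' (k + 2)) ∈ ξ := by rw [← s0]; exact hjk'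
  rcases fin3_cases_b k j' with e | e | e
  · exact absurd e hjk
  · -- j' = k + 1: the strand leaves through {x_{k+2}, x_k}
    rw [e] at hj' ⊢
    rw [s1] at hj'
    have step := okb_step hg ho hadj hst T hF't hFc hFs hx1 hx2 hx0 n12 (Ne.symm n02) (Ne.symm n01) hab hj' hokk
    rw [fin3_add_one_add_one_b, fin3_add_one_add_two_b]
    rcases step with h | h
    · exact absurd h hgoal
    · exact h
  · -- j' = k + 2: the strand leaves through {x_k, x_{k+1}}
    rw [e] at hj' ⊢
    rw [s2] at hj'
    have hba : s(faceVertex F' (k + 2), faceVertex F' (k + 1)) ∈ ξ := by rw [Sym2.eq_swap]; exact hab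
    have hbc : s(faceVertex F' (k + 1), faceVertex F' k) ∈ ξ := by rw [Sym2.eq_swap]; exact hj'
    have step := okb_step hg ho hadj hst T hF't hFc hFs hx2 hx1 hx0 (Ne.symm n12) (Ne.symm n01) (Ne.symm n02) hba hbc
      (okb_symm hokk)
    rw [fin3_add_two_add_one, fin3_add_two_add_two]
    rcases step with h | h
    · exact absurd h hgoal
    · exact okb_symm h

/-- the blue face invariant holds at every face reached by the strand of `Φ(σ)` from `z`. [cite: KhristoforovSmirnov2021, §1.2 Lemma 2, proof (arXiv v1 p. 3)] -/
theorem pface_of_reachable' {v : HexVertex} {i : Fin 3} (he : side v i = s(g, o)) (T : Finset (Site 2)) {F : HexVertex}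
    (hR : (sideGraph (Phi D g o T)).Reachable (sOf D g o T) F) : PFace D g o T F := by
  have hP : ∀ F, Relation.ReflTransGen (sideGraph (Phi D g o T)).Adj (sOf D g o T) F → PFace D g o T F := by
    intro F h
    induction h with
    | refl => exact pface_sOf hg ho hadj hst T
    | tail _ hbc ih => exact pface_step' hg ho hadj hst he T ih hbc
  exact hP F ((SimpleGraph.reachable_iff_reflTransGen _ _).1 hR)

/-- ★ **(A) THE CLASS `[z ↔ y₁]` FORCES THE BLUE CROSSING `∂_{y₀ z} ↔ A₁`**: if the strand of `Φ(σ)` from the disorder at `z` ends at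
the corner `y₁`, then `σ` has a blue path in `G` from the sub-arc `∂_{y₀ z}` to the arc `A₁` (the blue cells on one side of the
interface). [cite: KhristoforovSmirnov2021, §1.2 Lemma 2, proof (arXiv v1 p. 3): «∂_{u₁u₂}Ω ↔ ∂_{u₃u₄}Ω in σ if and only if [u₁u₄|u₂u₃] in ξ(σ)»] -/
theorem blueCross_of_reachable' {v : HexVertex} {i : Fin 3} (he : side v i = s(g, o)) (T : Finset (Site 2))
    (hR : (sideGraph (Phi D g o T)).Reachable (sOf D g o T) (yc D 1)) : BlueCross D g o T := by
  classical
  have hP : ∀ F, Relation.ReflTransGen (sideGraph (Phi D g o T)).Adj (sOf D g o T) F → PFace D g o T F := by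
    intro F h
    induction h with
    | refl => exact pface_sOf hg ho hadj hst T
    | tail _ hbc ih => exact pface_step' hg ho hadj hst he T ih hbc
  have hP1 := hP (yc D 1) ((SimpleGraph.reachable_iff_reflTransGen _ _).1 hR)
  by_cases hne : yc D 1 = sOf D g o T
  · -- the split face is `y₁`: `m = pos 1`, i.e. `g = v₁` is blue and `z` is the last mid-edge of `A₀`
    obtain ⟨h00, h01, h12, h2L⟩ := pos_facts (D := D)
    have hm : mOf D g o T = D.pos 1 :=
      eq_pos_of_sFace_eq_yc (lt_of_le_of_lt (mOf_le hg ho hadj hst T) (by omega)) hne.symm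
    have hp1 := zpos_lt_pos_one hg ho hadj hst
    have hgT : g ∈ T := by
      by_contra hgT
      unfold mOf at hm; rw [if_neg hgT] at hm; omega
    unfold mOf at hm; rw [if_pos hgT] at hm
    exact blueCross_of_last hg ho hadj hgT hm
  · exact blueCross_of_pface_yc_one hg ho hadj hst he T hP1 hne
/-- **the yellow propagation step between faces.** [cite: KhristoforovSmirnov2021, §1.2 Lemma 2, proof (arXiv v1 p. 3)] -/
theorem pfaceY_step' {v : HexVertex} {i : Fin 3} (he : side v i = s(g, o)) (T : Finset (Site 2)) {F F' : HexVertex}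
    (hP : PFaceY D g o T F) (hFF' : (sideGraph (Phi D g o T)).Adj F F') : PFaceY D g o T F' := by
  classical
  by_cases hgoal : YellowCross D g o T
  · exact Or.inl hgoal
  by_cases hFs : F' = sOf D g o T
  · rw [hFs]; exact pfaceY_sOf hg ho hadj hst T
  obtain ⟨j, rfl, hj⟩ := hFF'
  set ξ := Phi D g o T with hξdef
  have hξT := Phi_mem_TXb hg ho hadj hst he T
  have hsub : ξ ⊆ hBonds D := fun b hb => phiZ_subset _ T hb
  set k := oppIdx F j with hk
  set F' := oppFace F j with hF'def
  have hshared : side F' k = side F j := side_oppFace_oppIdx F j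
  have hjk' : side F' k ∈ ξ := by rw [hshared]; exact hj
  have hokk : OKy D g o T (faceVertex F' (k + 1)) (faceVertex F' (k + 2)) := by
    have := oky_of_pfaceY hP hgoal hj (rfl : side F j = s(faceVertex F (j + 1), faceVertex F (j + 2)))
    rw [hF'def, hk, faceVertex_oppFace_succ, faceVertex_oppFace_succ_succ]
    exact oky_symm this
  right
  intro j' hj'
  by_cases hjk : j' = k
  · rw [hjk]; exact hokk
  have hF't : F' ∈ triFacesTouching D.verts := mem_touching_of_side_mem D (hsub hj')
  have hs := sOf_mem_pair' hg ho hadj he T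
  have hdeg := xiDeg_le_two_of_mem_TXb D i hs hξT F'
  have hge : 2 ≤ xiDeg ξ F' := by
    rw [l1_xiDeg_eq]
    have hsub2 : ({k, j'} : Finset (Fin 3)) ⊆ ((Finset.univ : Finset (Fin 3)).filter fun i => side F' i ∈ ξ) := by
      intro x hx
      rw [Finset.mem_insert, Finset.mem_singleton] at hx
      rw [Finset.mem_filter]
      rcases hx with rfl | rfl
      · exact ⟨Finset.mem_univ _, hjk'⟩
      · exact ⟨Finset.mem_univ _, hj'⟩
    have hc : #({k, j'} : Finset (Fin 3)) = 2 := Finset.card_pair (Ne.symm hjk)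
    calc 2 = #({k, j'} : Finset (Fin 3)) := hc.symm
      _ ≤ _ := Finset.card_le_card hsub2
  have h2 : xiDeg ξ F' = 2 := le_antisymm hdeg hge
  have heven : ¬ Odd (xiDeg ξ F') := by rw [h2]; decide
  have hFc : F' ∉ corners D := by
    intro hc
    have hξT' := hξT
    rw [mem_TXb_iff] at hξT'
    apply heven
    apply (hξT'.2 _ hF't).2
    rw [Finset.mem_symmDiff, Finset.mem_singleton]; exact Or.inl ⟨hc, hFs⟩
  obtain ⟨s2, s1, s0⟩ := sides_from_b F' k
  have hx0 := faceVertex_mem F' k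
  have hx1 := faceVertex_mem F' (k + 1)
  have hx2 := faceVertex_mem F' (k + 2)
  have n01 : faceVertex F' k ≠ faceVertex F' (k + 1) := fun e => fin3_ne_add_one_b k (faceVertex_injective _ e)
  have n02 : faceVertex F' k ≠ faceVertex F' (k + 2) := fun e => fin3_ne_add_two_b k (faceVertex_injective _ e)
  have n12 : faceVertex F' (k + 1) ≠ faceVertex F' (k + 2) :=
    fun e => fin3_add_two_ne_add_one_b k (faceVertex_injective _ e).symm
  have hab : s(faceVertex F' (k + 1), faceVertex F' (k + 2)) ∈ ξ := by rw [← s0]; exact hjk'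
  rcases fin3_cases_b k j' with e | e | e
  · exact absurd e hjk
  · rw [e] at hj' ⊢
    rw [s1] at hj'
    have step := oky_step hg ho hadj hst T hF't hFc hFs hx1 hx2 hx0 n12 (Ne.symm n02) (Ne.symm n01) hab hj' hokk
    rw [fin3_add_one_add_one_b, fin3_add_one_add_two_b]
    rcases step with h | h
    · exact absurd h hgoal
    · exact h
  · rw [e] at hj' ⊢
    rw [s2] at hj'
    have hba : s(faceVertex F' (k + 2), faceVertex F' (k + 1)) ∈ ξ := by rw [Sym2.eq_swap]; exact hab
    have hbc : s(faceVertex F' (k + 1), faceVertex F' k) ∈ ξ := by rw [Sym2.eq_swap]; exact hj'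
    have step := oky_step hg ho hadj hst T hF't hFc hFs hx2 hx1 hx0 (Ne.symm n12) (Ne.symm n01) (Ne.symm n02) hba hbc
      (oky_symm hokk)
    rw [fin3_add_two_add_one, fin3_add_two_add_two]
    rcases step with h | h
    · exact absurd h hgoal
    · exact oky_symm h

/-- the yellow face invariant holds at every face reached by the strand of `Φ(σ)` from `z`. [cite: KhristoforovSmirnov2021, §1.2 Lemma 2, proof (arXiv v1 p. 3)] -/
theorem pfaceY_of_reachable' {v : HexVertex} {i : Fin 3} (he : side v i = s(g, o)) (T : Finset (Site 2)) {F : HexVertex}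
    (hR : (sideGraph (Phi D g o T)).Reachable (sOf D g o T) F) : PFaceY D g o T F := by
  have hP : ∀ F, Relation.ReflTransGen (sideGraph (Phi D g o T)).Adj (sOf D g o T) F → PFaceY D g o T F := by
    intro F h
    induction h with
    | refl => exact pfaceY_sOf hg ho hadj hst T
    | tail _ hbc ih => exact pfaceY_step' hg ho hadj hst he T ih hbc
  exact hP F ((SimpleGraph.reachable_iff_reflTransGen _ _).1 hR)

/-- ★ **(B) THE CLASS `[z ↔ y₀]` FORCES THE YELLOW CROSSING `∂_{z y₁} ↔ A₂`.** [cite: KhristoforovSmirnov2021, §1.2 Lemma 2, proof (arXiv v1 p. 3)] -/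
theorem yellowCross_of_reachable' {v : HexVertex} {i : Fin 3} (he : side v i = s(g, o)) (T : Finset (Site 2))
    (hR : (sideGraph (Phi D g o T)).Reachable (sOf D g o T) (yc D 0)) : YellowCross D g o T := by
  classical
  have hP : ∀ F, Relation.ReflTransGen (sideGraph (Phi D g o T)).Adj (sOf D g o T) F → PFaceY D g o T F := by
    intro F h
    induction h with
    | refl => exact pfaceY_sOf hg ho hadj hst T
    | tail _ hbc ih => exact pfaceY_step' hg ho hadj hst he T ih hbc
  have hP0 := hP (yc D 0) ((SimpleGraph.reachable_iff_reflTransGen _ _).1 hR)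
  by_cases hne : yc D 0 = sOf D g o T
  · obtain ⟨h00, h01, h12, h2L⟩ := pos_facts (D := D)
    have hm : mOf D g o T = D.pos 0 :=
      eq_pos_of_sFace_eq_yc (lt_of_le_of_lt (mOf_le hg ho hadj hst T) (by omega)) hne.symm
    rw [h00] at hm
    have hgT : g ∉ T := by
      intro hgT
      unfold mOf at hm; rw [if_pos hgT] at hm; omega
    unfold mOf at hm; rw [if_neg hgT] at hm
    exact yellowCross_of_first hg ho hadj hgT hm
  · exact yellowCross_of_pfaceY_yc_zero hg ho hadj hst he T hP0 hne

/-! ### on `A₀` the strand from `z` never ends at `y₂` — from the bond invariants -/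

omit hg ho hadj hst in
/-- an `H_G`-side of the corner face `y₂`, read from its `G`-endpoint `a` (necessarily the marked site `v₂`), is the boundary dart
`predDart 2` (last dart of `A₁`) or `markDart 2` (first dart of `A₂`); its other endpoint is an outer cell. [cite: BollobasRiordan2006, Ch. 7 §7.2.2 pp. 191–195] -/
theorem dart_of_side_yc_two {j : Fin 3} {a c : Site 2} (he : side (yc D 2) j = s(a, c)) (ha : a ∈ D.verts) (hac : a ≠ c) :
    c ∉ D.verts ∧ ((a, c) = predDart D 2 ∨ (a, c) = D.markDart 2) := by
  obtain ⟨w, h0, h1, h2, hor⟩ := isCornerFace_typeII D (yc_spec D 2)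
  have ha' : a ∈ hexFaceVertices (yc D 2) := by
    have : a ∈ (side (yc D 2) j : Sym2 (Site 2)) := by rw [he]; exact Sym2.mem_mk_left a c
    unfold side at this
    rcases Sym2.mem_iff.1 this with e | e <;> rw [e] <;> exact faceVertex_mem _ _
  have haw : a = faceVertex (yc D 2) w := by
    obtain ⟨b, hb⟩ := mem_hexFaceVertices_iff_faceVertex.1 ha'
    rcases fin3_cases_b w b with e | e | e
    · rw [hb, e]
    · exact absurd (e ▸ hb ▸ ha) h1
    · exact absurd (e ▸ hb ▸ ha) h2
  have hc' : c ∈ hexFaceVertices (yc D 2) := by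
    have : c ∈ (side (yc D 2) j : Sym2 (Site 2)) := by rw [he]; exact Sym2.mem_mk_right a c
    unfold side at this
    rcases Sym2.mem_iff.1 this with e | e <;> rw [e] <;> exact faceVertex_mem _ _
  obtain ⟨b, hb⟩ := mem_hexFaceVertices_iff_faceVertex.1 hc'
  have hb' : b = w + 1 ∨ b = w + 2 := by
    rcases fin3_cases_b w b with e | e | e
    · exact absurd (haw.trans (e ▸ hb).symm) hac
    · exact Or.inl e
    · exact Or.inr e
  have hcG : c ∉ D.verts := by
    rcases hb' with e | e
    · rw [hb, e]; exact h1
    · rw [hb, e]; exact h2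
  have ha2 : a = D.markSite 2 := haw.trans h0
  refine ⟨hcG, ?_⟩
  rcases hor with ⟨hp1, hm2⟩ | ⟨hm1, hp2⟩
  · rcases hb' with rfl | rfl
    · exact Or.inl (Prod.ext (by rw [predDart_fst]; exact ha2) (by rw [hb]; exact hp1))
    · exact Or.inr (Prod.ext ha2 (by rw [hb]; exact hm2))
  · rcases hb' with rfl | rfl
    · exact Or.inr (Prod.ext ha2 (by rw [hb]; exact hm1))
    · exact Or.inl (Prod.ext (by rw [predDart_fst]; exact ha2) (by rw [hb]; exact hp2))

omit hg ho hadj hst in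
/-- the marked site `v₂` lies on the arc `A₁` (as its last site). [folklore] [cite: KhristoforovSmirnov2021, §1.2 (arXiv v1 pp. 2–3)] -/
theorem markSite_two_mem_arc_one : D.markSite 2 ∈ D.arc 1 := by
  have h := markSite_mem_arc_sub_one (D := D) 2
  have e : ((2 : Fin 3) - 1) = 1 := by decide
  rwa [e] at h

/-- ★ **ON `A₀` THE STRAND OF `Φ(σ)` FROM `z` NEVER ENDS AT `y₂`** (Khristoforov–Smirnov: on `∂_jΩ` the pattern `[z ↔ u_j]` is
absent), proved on the percolation side from the bond invariants: if the strand reached `y₂`, both face invariants would hold there;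
the side of `y₂` carrying the strand is `predDart 2` (outer cell on `A₁`, blue: the blue invariant gives the blue crossing outright,
and the yellow `G`-endpoint `v₂ ∈ A₂` is yellow-joined to `∂_{z y₁}`, the yellow crossing) or `markDart 2` (outer cell on `A₂`, yellow:
symmetrically); but the two crossings do not coexist. [cite: KhristoforovSmirnov2021, §2 eq. (4) (arXiv v1 p. 5) with §1.2 Lemma 2, proof (p. 3); BollobasRiordan2006, Ch. 7 Lemma 5 (p. 193)] -/
theorem not_reachable_yc_two_Phi {v : HexVertex} {i : Fin 3} (he : side v i = s(g, o)) (T : Finset (Site 2)) :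
    ¬ (sideGraph (Phi D g o T)).Reachable (sOf D g o T) (yc D 2) := by
  classical
  intro hR
  have hPb := pface_of_reachable' hg ho hadj hst he T hR
  have hPy := pfaceY_of_reachable' hg ho hadj hst he T hR
  have hξT := Phi_mem_TXb hg ho hadj hst he T
  have hs := sOf_mem_pair' hg ho hadj he T
  -- `y₂` is not a face of the bond of `z`
  have hne : yc D 2 ≠ sOf D g o T := by
    rw [Finset.mem_insert, Finset.mem_singleton] at hs
    rcases hs with e | e
    · rw [e]; exact (ne_yc_two_of_stretch_zero (j := i) he hg ho hst).symm
    · rw [e]; exact (ne_yc_two_of_stretch_zero (j := oppIdx v i) (by rw [side_oppFace_oppIdx]; exact he) hg ho hst).symm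
  -- so `y₂` is odd in `Φ(σ)`: some side of `y₂` lies in `Φ(σ)`
  have hpar := ((mem_TXb_iff v i (sOf D g o T) (Phi D g o T)).1 hξT).2
  have hodd : Odd (xiDeg (Phi D g o T) (yc D 2)) := by
    apply (hpar _ (yc_mem_touching D 2)).2
    rw [Finset.mem_symmDiff, Finset.mem_singleton]
    exact Or.inl ⟨(mem_corners D).2 ⟨2, rfl⟩, hne⟩
  obtain ⟨j, hj⟩ : ∃ j : Fin 3, side (yc D 2) j ∈ Phi D g o T := by
    by_contra h
    rw [l1_xiDeg_eq, Finset.filter_false_of_mem (fun j _ hj => h ⟨j, hj⟩), Finset.card_empty] at hodd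
    exact absurd hodd (by decide)
  -- that side is `{v₂, c}` with `(v₂, c)` the dart `predDart 2` or `markDart 2`
  obtain ⟨a, c, hac, haG, hadj'⟩ := exists_rep_of_mem_hBonds D (phiZ_subset _ T hj)
  obtain ⟨hcG, hdart⟩ := dart_of_side_yc_two hac haG hadj'.ne
  have ha2 : a = D.markSite 2 := by
    rcases hdart with h | h
    · have := congrArg Prod.fst h; rw [predDart_fst] at this; exact this
    · exact congrArg Prod.fst h
  have ha1 : a ∈ D.arc 1 := by rw [ha2]; exact markSite_two_mem_arc_one
  have ha2' : a ∈ D.arc 2 := by rw [ha2]; exact D.markSite_mem_arc 2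
  have hmem : a ∈ T ↔ frz D (mOf D g o T) (D.dpos (a, c)) = false :=
    (mk_mem_phiZ_iff_of_mem_not_mem (mOf D g o T) T hadj' haG hcG).1 (by rw [← hac]; exact hj)
  -- both crossings follow
  have hBY : BlueCross D g o T ∧ YellowCross D g o T := by
    rcases hdart with hd | hd
    · -- through `predDart 2`: the outer cell lies on `A₁` and is blue
      have hst1 : D.stretchIdx₃ (D.dpos (a, c)) = 1 := by
        rw [hd, stretchIdx₃_predDart]; decide
      have hfrz : frz D (mOf D g o T) (D.dpos (a, c)) = true := frz_of_stretchIdx_one hst1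
      have haT : a ∉ T := fun haT => by
        have := hmem.1 haT; rw [hfrz] at this; exact Bool.noConfusion this
      refine ⟨?_, ?_⟩
      · by_contra hgoal
        exact (okb_of_pface hPb hgoal hj hac).2.2.1 haG hcG hfrz hst1
      · by_contra hgoal
        exact hgoal (yellowCross_of_yconn ((oky_of_pfaceY hPy hgoal hj hac).1 haG haT) ha2')
    · -- through `markDart 2`: the outer cell lies on `A₂` and is yellow
      have hst2 : D.stretchIdx₃ (D.dpos (a, c)) = 2 := by rw [hd, stretchIdx₃_markDart]
      have hfrz : frz D (mOf D g o T) (D.dpos (a, c)) = false := frz_of_stretchIdx_two hst2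
      have haT : a ∈ T := hmem.2 hfrz
      refine ⟨?_, ?_⟩
      · by_contra hgoal
        exact hgoal (blueCross_of_bconn ((okb_of_pface hPb hgoal hj hac).1 haG haT) ha1)
      · by_contra hgoal
        exact (oky_of_pfaceY hPy hgoal hj hac).2.2.1 haG hcG hfrz hst2
  exact not_blueCross_of_yellowCross hg ho hadj hst T hBY.1 hBY.2

/-- ★ **`[z ↔ y₂]` IS ABSENT ON `A₀`, any mid-edge, either half**: no configuration of the XOR space at a mid-edge of `A₀` links its odd
endpoint to `y₂`. [cite: KhristoforovSmirnov2021, §2 eq. (4) (arXiv v1 p. 5)] -/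
theorem not_reachable_yc_two' {v : HexVertex} {i : Fin 3} (he : side v i = s(g, o)) {s : HexVertex}
    (hs : s ∈ ({v, oppFace v i} : Finset HexVertex)) {ξ : Finset (Sym2 (Site 2))} (hξ : ξ ∈ TXb D v i s) :
    ¬ (sideGraph ξ).Reachable s (yc D 2) := by
  obtain ⟨T, -, rfl, rfl⟩ := exists_eq_Phi' hg ho hadj hst he hs hξ
  exact not_reachable_yc_two_Phi hg ho hadj hst he T

/-- ★ **(D) on the arc `A₀` the strand from `z` ends at `y₀` or at `y₁`** — any mid-edge, either half: a corner endpoint (`z` next to a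
mark) is linked to itself; otherwise the strand from the odd endpoint ends at another odd face, a corner, and not `y₂`.
[cite: KhristoforovSmirnov2021, §2 (the three link patterns, arXiv v1 pp. 3–4) and eq. (4) (p. 5)] -/
theorem reachable_zero_or_one' {v : HexVertex} {i : Fin 3} (he : side v i = s(g, o)) {s : HexVertex}
    (hs : s ∈ ({v, oppFace v i} : Finset HexVertex)) {ξ : Finset (Sym2 (Site 2))} (hξ : ξ ∈ TXb D v i s) :
    (sideGraph ξ).Reachable s (yc D 0) ∨ (sideGraph ξ).Reachable s (yc D 1) := by
  classical
  have hb : side v i ∈ hBonds D := side_mem_hBonds_of_eq hg hadj he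
  have hs2 : s ≠ yc D 2 := by
    rw [Finset.mem_insert, Finset.mem_singleton] at hs
    rcases hs with e | e
    · rw [e]; exact ne_yc_two_of_stretch_zero (j := i) he hg ho hst
    · rw [e]; exact ne_yc_two_of_stretch_zero (j := oppIdx v i) (by rw [side_oppFace_oppIdx]; exact he) hg ho hst
  by_cases hsc : s ∈ corners D
  · -- `s` is the corner `y₀` or `y₁`: linked to itself
    obtain ⟨a, ha⟩ := (mem_corners D).1 hsc
    have ha3 : a = 0 ∨ a = 1 ∨ a = 2 := by fin_cases a <;> simp
    rcases ha3 with rfl | rfl | rfl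
    · rw [ha]; exact Or.inl (SimpleGraph.Reachable.refl _)
    · rw [ha]; exact Or.inr (SimpleGraph.Reachable.refl _)
    · exact absurd ha hs2
  · -- `s` is odd of degree `1`: its strand ends at another odd face, a corner, not `y₂`
    obtain ⟨hsub, hpar⟩ := (mem_TXb_iff v i s ξ).1 hξ
    have hξh : ξ ⊆ hBonds D := fun b hb' => Finset.mem_of_mem_erase (hsub hb')
    have hdeg := xiDeg_le_two_of_mem_TXb D i hs hξ
    have hsT : s ∈ triFacesTouching D.verts := by
      rw [Finset.mem_insert, Finset.mem_singleton] at hs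
      rcases hs with e | e
      · rw [e]; exact mem_touching_of_side_mem D hb
      · rw [e]; exact mem_touching_of_side_mem D (j := oppIdx v i) (by rw [side_oppFace_oppIdx]; exact hb)
    have hodd : Odd (xiDeg ξ s) := (hpar s hsT).2 (by
      rw [Finset.mem_symmDiff, Finset.mem_singleton]; exact Or.inr ⟨rfl, hsc⟩)
    obtain ⟨⟨Y, hYs, hYodd, hR⟩, -⟩ := odd_component D hξh hdeg hsT hodd
    have hYT : Y ∈ triFacesTouching D.verts := by
      obtain ⟨j, hj⟩ : ∃ j : Fin 3, side Y j ∈ ξ := by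
        by_contra h
        rw [l1_xiDeg_eq, Finset.filter_false_of_mem (fun j _ hj => h ⟨j, hj⟩), Finset.card_empty] at hYodd
        exact absurd hYodd (by decide)
      exact mem_touching_of_side_mem D (hξh hj)
    have hYc : Y ∈ corners D := by
      have := (hpar Y hYT).1 hYodd
      rw [Finset.mem_symmDiff, Finset.mem_singleton] at this
      rcases this with ⟨h, -⟩ | ⟨h, -⟩
      · exact h
      · exact absurd h hYs
    obtain ⟨a, rfl⟩ := (mem_corners D).1 hYc
    have ha3 : a = 0 ∨ a = 1 ∨ a = 2 := by fin_cases a <;> simp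
    rcases ha3 with rfl | rfl | rfl
    · exact Or.inl hR
    · exact Or.inr hR
    · exact absurd hR (not_reachable_yc_two' hg ho hadj hst he hs hξ)

/-! ### Lemma 2 and the dictionary, any mid-edge of `A₀` -/

omit hg ho hadj hst
variable {v : HexVertex} {i : Fin 3} (he : side v i = s(g, o))
include hg ho hadj hst he

/-- ★★ **KHRISTOFOROV–SMIRNOV'S LEMMA 2 AT `(y₀, z, y₁, y₂)`, first link pattern, ANY mid-edge `z` of `A₀`**: the strand of `ξ(σ)` from
`z` ends at `y₁` iff `σ` has a blue crossing `∂_{y₀ z} ↔ A₁`. [cite: KhristoforovSmirnov2021, §1.2 Lemma 2 (arXiv v1 p. 3): «∂_{u₁u₂}Ω ↔ ∂_{u₃u₄}Ω in σ if and only if [u₁u₄|u₂u₃] in ξ(σ)»] -/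
theorem inClassX_one_iff_blueCross' (T : Finset (Site 2)) :
    InClassX D (faceVertex v (i + 1)) (faceVertex v (i + 2)) (sOf D g o T) 1 (Phi D g o T) ↔ BlueCross D g o T := by
  have hξ := Phi_mem_TXb hg ho hadj hst he T
  have hs := sOf_mem_pair' hg ho hadj he T
  rw [hbK_inClassX_iff]
  constructor
  · rintro ⟨-, hR⟩
    exact blueCross_of_reachable' hg ho hadj hst he T hR
  · intro hB
    refine ⟨hξ, ?_⟩
    rcases reachable_zero_or_one' hg ho hadj hst he hs hξ with hR | hR
    · exact absurd (yellowCross_of_reachable' hg ho hadj hst he T hR) (fun hY => not_blueCross_of_yellowCross hg ho hadj hst T hB hY)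
    · exact hR

/-- ★★ **KHRISTOFOROV–SMIRNOV'S LEMMA 2, second link pattern, ANY mid-edge of `A₀`**: the strand from `z` ends at `y₀` iff `σ` has a
yellow crossing `∂_{z y₁} ↔ A₂`. [cite: KhristoforovSmirnov2021, §1.2 Lemma 2 (arXiv v1 p. 3)] -/
theorem inClassX_zero_iff_yellowCross' (T : Finset (Site 2)) :
    InClassX D (faceVertex v (i + 1)) (faceVertex v (i + 2)) (sOf D g o T) 0 (Phi D g o T) ↔ YellowCross D g o T := by
  have hξ := Phi_mem_TXb hg ho hadj hst he T
  have hs := sOf_mem_pair' hg ho hadj he T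
  rw [hbK_inClassX_iff]
  constructor
  · rintro ⟨-, hR⟩
    exact yellowCross_of_reachable' hg ho hadj hst he T hR
  · intro hY
    refine ⟨hξ, ?_⟩
    rcases reachable_zero_or_one' hg ho hadj hst he hs hξ with hR | hR
    · exact hR
    · exact absurd (blueCross_of_reachable' hg ho hadj hst he T hR) (fun hB => not_blueCross_of_yellowCross hg ho hadj hst T hB hY)

/-- ★ **DICHOTOMY OF COLOURINGS at any mid-edge of `A₀`**: every colouring of `G` has the blue crossing `∂_{y₀ z} ↔ A₁` or the yellow
crossing `∂_{z y₁} ↔ A₂` (the strand from `z` ends at `y₁` or at `y₀`), never both. [cite: KhristoforovSmirnov2021, §1.2 Lemma 2 (arXiv v1 p. 3); BollobasRiordan2006, Ch. 7 Lemma 5 (p. 193)] -/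
theorem blueCross_xor_yellowCross (T : Finset (Site 2)) : Xor (BlueCross D g o T) (YellowCross D g o T) := by
  have hξ := Phi_mem_TXb hg ho hadj hst he T
  have hs := sOf_mem_pair' hg ho hadj he T
  rcases reachable_zero_or_one' hg ho hadj hst he hs hξ with hR | hR
  · have hY := yellowCross_of_reachable' hg ho hadj hst he T hR
    exact Or.inr ⟨hY, fun hB => not_blueCross_of_yellowCross hg ho hadj hst T hB hY⟩
  · have hB := blueCross_of_reachable' hg ho hadj hst he T hR
    exact Or.inl ⟨hB, fun hY => not_blueCross_of_yellowCross hg ho hadj hst T hB hY⟩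

open Classical in
/-- **`#{σ : blue crossing} + #{σ : yellow crossing} = 2 ^ #G`** at any mid-edge of `A₀`. [cite: KhristoforovSmirnov2021, §1.2 Lemma 2 (arXiv v1 p. 3)] -/
theorem card_filter_blueCross_add_card_filter_yellowCross :
    #(D.verts.powerset.filter fun T => BlueCross D g o T) + #(D.verts.powerset.filter fun T => YellowCross D g o T) = 2 ^ #D.verts := by
  have hY : (D.verts.powerset.filter fun T => YellowCross D g o T) = D.verts.powerset.filter fun T => ¬ BlueCross D g o T := by
    apply Finset.filter_congr
    intro T _
    have hx := blueCross_xor_yellowCross hg ho hadj hst he T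
    constructor
    · intro hYc hB; exact not_blueCross_of_yellowCross hg ho hadj hst T hB hYc
    · intro hB
      rcases hx with ⟨h, -⟩ | ⟨h, -⟩
      · exact absurd h hB
      · exact h
  rw [hY, Finset.card_filter_add_card_filter_not, Finset.card_powerset]

/-! ### counting: `N_j(z)` = the number of colourings with the corresponding crossing -/

open Classical in
/-- **transport of counts through `Φ`** (both halves), any mid-edge of `A₀`. [cite: KhristoforovSmirnov2021, §1.2 Lemma 2, proof (arXiv v1 p. 3): «This map is a bijection»; §2 Definition 3 (p. 4)] -/
theorem classCount_eq_card_filter' (j : Fin 3) :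
    classCount D v i j = #(D.verts.powerset.filter fun T =>
      InClassX D (faceVertex v (i + 1)) (faceVertex v (i + 2)) (sOf D g o T) j (Phi D g o T)) := by
  have key : ∀ s ∈ ({v, oppFace v i} : Finset HexVertex),
      #((TXb D v i s).filter fun ξ => InClassX D (faceVertex v (i + 1)) (faceVertex v (i + 2)) s j ξ) =
        #(D.verts.powerset.filter fun T => sOf D g o T = s ∧
          InClassX D (faceVertex v (i + 1)) (faceVertex v (i + 2)) (sOf D g o T) j (Phi D g o T)) := by
    intro s hs
    symm
    apply Finset.card_bij (fun T _ => Phi D g o T)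
    · intro T hT
      rw [Finset.mem_filter] at hT ⊢
      obtain ⟨-, hsT, hcl⟩ := hT
      rw [hsT] at hcl
      exact ⟨hsT ▸ Phi_mem_TXb hg ho hadj hst he T, hcl⟩
    · intro T hT T' hT' h
      exact Phi_injOn hg ho hadj hst he (Finset.mem_coe.2 (Finset.mem_filter.1 hT).1) (Finset.mem_coe.2 (Finset.mem_filter.1 hT').1) h
    · intro ξ hξ
      rw [Finset.mem_filter] at hξ
      obtain ⟨T, hTG, hTξ, hTs⟩ := exists_eq_Phi' hg ho hadj hst he hs hξ.1
      refine ⟨T, ?_, hTξ⟩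
      rw [Finset.mem_filter, Finset.mem_powerset]
      refine ⟨hTG, hTs, ?_⟩
      rw [hTs, hTξ]; exact hξ.2
  have hvo : v ≠ oppFace v i := h1_ne_oppFace v i
  unfold classCount
  rw [key v (by simp), key (oppFace v i) (by simp), ← Finset.card_union_of_disjoint]
  · congr 1
    ext T
    simp only [Finset.mem_union, Finset.mem_filter]
    constructor
    · rintro (⟨h1, -, h2⟩ | ⟨h1, -, h2⟩) <;> exact ⟨h1, h2⟩
    · rintro ⟨h1, h2⟩
      have hs := sOf_mem_pair' hg ho hadj he T
      rw [Finset.mem_insert, Finset.mem_singleton] at hs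
      rcases hs with e | e
      · exact Or.inl ⟨h1, e, h2⟩
      · exact Or.inr ⟨h1, e, h2⟩
  · rw [Finset.disjoint_filter]
    intro T _ h1 h2
    exact hvo (h1.1.symm.trans h2.1)

open Classical in
/-- ★★★ **`N₁(z)` IS THE NUMBER OF COLOURINGS WITH A BLUE CROSSING `∂_{y₀ z} ↔ A₁`**, any mid-edge `z` of `A₀`. [cite: KhristoforovSmirnov2021, §1.2 Lemma 2 (arXiv v1 p. 3) and §2 eq. (4) (p. 5)] -/
theorem classCount_one_eq_card_blueCross' :
    classCount D v i 1 = #(D.verts.powerset.filter fun T => BlueCross D g o T) := by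
  rw [classCount_eq_card_filter' hg ho hadj hst he 1]
  congr 1
  exact Finset.filter_congr fun T _ => inClassX_one_iff_blueCross' hg ho hadj hst he T

open Classical in
/-- ★★★ **`N₀(z)` IS THE NUMBER OF COLOURINGS WITH A YELLOW CROSSING `∂_{z y₁} ↔ A₂`**, any mid-edge of `A₀`. [cite: KhristoforovSmirnov2021, §1.2 Lemma 2 (arXiv v1 p. 3) and §2 eq. (4) (p. 5)] -/
theorem classCount_zero_eq_card_yellowCross' :
    classCount D v i 0 = #(D.verts.powerset.filter fun T => YellowCross D g o T) := by
  rw [classCount_eq_card_filter' hg ho hadj hst he 0]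
  congr 1
  exact Finset.filter_congr fun T _ => inClassX_zero_iff_yellowCross' hg ho hadj hst he T

open Classical in
/-- ★ **`N₂(z) = 0` ON `A₀`**, any mid-edge (Khristoforov–Smirnov: on `∂_jΩ` the pattern `[z ↔ u_j]` is absent). [cite: KhristoforovSmirnov2021, §2 eq. (4) (arXiv v1 p. 5)] -/
theorem classCount_two_eq_zero' : classCount D v i 2 = 0 := by
  have key : ∀ s ∈ ({v, oppFace v i} : Finset HexVertex), ∀ ξ ∈ TXb D v i s,
      ¬ InClassX D (faceVertex v (i + 1)) (faceVertex v (i + 2)) s 2 ξ := by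
    intro s hs ξ hξ hcl
    rw [hbK_inClassX_iff] at hcl
    exact not_reachable_yc_two' hg ho hadj hst he hs hξ hcl.2
  unfold classCount
  rw [Finset.card_eq_zero.2 (Finset.filter_eq_empty_iff.2 fun ξ hξ => key v (by simp) ξ hξ),
    Finset.card_eq_zero.2 (Finset.filter_eq_empty_iff.2 fun ξ hξ => key (oppFace v i) (by simp) ξ hξ)]

/-- **`N₀(z) + N₁(z) = 2 ^ #G` on `A₀`**, any mid-edge. [cite: KhristoforovSmirnov2021, §2 eq. (4) (arXiv v1 p. 5)] -/
theorem classCount_zero_add_classCount_one' : classCount D v i 0 + classCount D v i 1 = 2 ^ #D.verts := by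
  classical
  rw [classCount_zero_eq_card_yellowCross' hg ho hadj hst he, classCount_one_eq_card_blueCross' hg ho hadj hst he, add_comm]
  convert card_filter_blueCross_add_card_filter_yellowCross hg ho hadj hst he using 3

/-! ### the probabilities: Khristoforov–Smirnov's eq. (4), percolation side, at every mid-edge of `A₀` -/

omit hg ho hadj hst he in
/-- locality of paths inside `G`: only the states of the sites of `G` matter. [folklore] -/
private theorem inter_eq_inter_inter_b (σ : Set (Site 2)) :
    (D.verts : Set (Site 2)) ∩ σ = (D.verts : Set (Site 2)) ∩ (σ ∩ (D.verts : Set (Site 2))) := by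
  ext x; simp only [Set.mem_inter_iff]; tauto

omit hg ho hadj hst he in
/-- locality, complement version. [folklore] -/
private theorem inter_compl_eq_b (σ : Set (Site 2)) :
    (D.verts : Set (Site 2)) ∩ σᶜ = (D.verts : Set (Site 2)) ∩ (σ ∩ (D.verts : Set (Site 2)))ᶜ := by
  ext x; simp only [Set.mem_inter_iff, Set.mem_compl_iff]; tauto

open Classical in
/-- ★★★ **KhS eq. (4), PERCOLATION SIDE, `H₁`, EVERY mid-edge `z` of `A₀`**: `H₁(z) = P_{1/2}[∂_{y₀ z}Ω ↔ A₁]` (open crossing of `G`).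
[cite: KhristoforovSmirnov2021, §2 eq. (4) (arXiv v1 p. 5) with §1.2 Lemma 2 (p. 3)] -/
theorem hobs_one_eq_prob' : Hobs D v i 1 = (triSitePercolation half).real (arcToCrossing D g o) := by
  unfold Hobs arcToCrossing
  rw [classCount_one_eq_card_blueCross' hg ho hadj hst he,
    triSitePercolation_half_real_setOf_eq_card_div D.verts (fun σ => by rw [← inter_eq_inter_inter_b])]
  unfold BlueCross
  congr 2

open Classical in
/-- ★★★ **KhS eq. (4), PERCOLATION SIDE, `H₀`, EVERY mid-edge of `A₀`**: `H₀(z) = P_{1/2}[∂_{z y₁}Ω ↔ A₂ by a closed path]`.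
[cite: KhristoforovSmirnov2021, §2 eq. (4) (arXiv v1 p. 5) with §1.2 Lemma 2 (p. 3)] -/
theorem hobs_zero_eq_prob' : Hobs D v i 0 = (triSitePercolation half).real (arcFromClosedCrossing D g o) := by
  unfold Hobs arcFromClosedCrossing
  rw [classCount_zero_eq_card_yellowCross' hg ho hadj hst he,
    triSitePercolation_half_real_setOf_eq_card_div D.verts (fun σ => by rw [← inter_compl_eq_b])]
  unfold YellowCross
  congr 2

/-- ★ **`H₂(z) = 0` at EVERY mid-edge of `A₀`.** [cite: KhristoforovSmirnov2021, §2 eq. (4) (arXiv v1 p. 5)] -/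
theorem hobs_two_eq_zero' : Hobs D v i 2 = 0 := by
  unfold Hobs
  rw [classCount_two_eq_zero' hg ho hadj hst he, Nat.cast_zero, zero_div]

/-- ★ **`H₀(z) + H₁(z) = 1` at EVERY mid-edge of `A₀`.** [cite: KhristoforovSmirnov2021, §2 eq. (4) (arXiv v1 p. 5)] -/
theorem hobs_zero_add_hobs_one' : Hobs D v i 0 + Hobs D v i 1 = 1 := by
  unfold Hobs
  rw [← add_div, ← Nat.cast_add, classCount_zero_add_classCount_one' hg ho hadj hst he]
  have h : (2 : ℝ) ^ #D.verts ≠ 0 := pow_ne_zero _ two_ne_zero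
  rw [Nat.cast_pow, Nat.cast_ofNat, div_self h]

/-- ★ **`F(z) = H₀(z) + τ H₁(z)` at EVERY mid-edge of `A₀`.** [cite: KhristoforovSmirnov2021, §2 Definition 3 (p. 4) and eq. (4) (arXiv v1 p. 5)] -/
theorem fobs_eq' : Fobs D v i = (Hobs D v i 0 : ℂ) + tau * (Hobs D v i 1 : ℂ) := by
  unfold Fobs
  rw [Fin.sum_univ_three, hobs_two_eq_zero' hg ho hadj hst he]
  push_cast
  simp only [Fin.val_zero, Fin.val_one, pow_zero, pow_one, one_mul, mul_zero, add_zero]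

/-- ★★★ **KHRISTOFOROV–SMIRNOV eq. (4) on the arc `A₀`, EVERY mid-edge**: `F(z) = P[∂_{z y₁} ↔ A₂ (closed)]·τ⁰ + P[∂_{y₀ z} ↔ A₁ (open)]·τ¹`,
the two probabilities summing to one. [cite: KhristoforovSmirnov2021, §2 eq. (4) (arXiv v1 p. 5)] -/
theorem fobs_eq_crossingProbs' :
    Fobs D v i = ((triSitePercolation half).real (arcFromClosedCrossing D g o) : ℂ) +
      tau * ((triSitePercolation half).real (arcToCrossing D g o) : ℂ) ∧
    (triSitePercolation half).real (arcFromClosedCrossing D g o) + (triSitePercolation half).real (arcToCrossing D g o) = 1 := by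
  rw [← hobs_zero_eq_prob' hg ho hadj hst he, ← hobs_one_eq_prob' hg ho hadj hst he]
  exact ⟨fobs_eq' hg ho hadj hst he, hobs_zero_add_hobs_one' hg ho hadj hst he⟩

open Classical in
/-- ★★★ **KhS eq. (4), PERCOLATION SIDE, `H₀`, printed (open) form, EVERY mid-edge of `A₀`**: `H₀(z) = P_{1/2}[∂_{z y₁}Ω ↔ A₂]` with
`↔` an open path of `G`. [cite: KhristoforovSmirnov2021, §2 eq. (4) (arXiv v1 p. 5)] -/
theorem hobs_zero_eq_prob_open' : Hobs D v i 0 = (triSitePercolation half).real (arcFromCrossing D g o) := by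
  unfold Hobs arcFromCrossing
  rw [classCount_zero_eq_card_yellowCross' hg ho hadj hst he, card_filter_yellowCross_eq]
  convert (triSitePercolation_half_real_setOf_eq_card_div (P := fun σ => ∃ a ∈ arcFrom D g o, ∃ b ∈ D.arc 2,
      PathIn triGraph ((D.verts : Set (Site 2)) ∩ σ) a b) D.verts fun σ => by rw [← inter_eq_inter_inter_b]).symm using 4
  exact (Finset.filter_congr_decidable _ _ _).symm

/-- ★★★ **KHRISTOFOROV–SMIRNOV eq. (4) VERBATIM on `∂_jΩ = A₀`, EVERY mid-edge `z`** (`u_{j+1} = y₀`, `u_{j−1} = y₁`):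
`F(z) = P^perc[∂_{z y₁}Ω ↔ A₂]·τ⁰ + P^perc[∂_{y₀ z}Ω ↔ A₁]·τ¹`, both `↔` open paths of critical site percolation on `G`, the two
probabilities summing to `1`. [cite: KhristoforovSmirnov2021, §2 eq. (4) (arXiv v1 p. 5)] -/
theorem fobs_eq_openCrossingProbs' :
    Fobs D v i = ((triSitePercolation half).real (arcFromCrossing D g o) : ℂ) +
      tau * ((triSitePercolation half).real (arcToCrossing D g o) : ℂ) ∧
    (triSitePercolation half).real (arcFromCrossing D g o) + (triSitePercolation half).real (arcToCrossing D g o) = 1 := by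
  rw [← hobs_zero_eq_prob_open' hg ho hadj hst he, ← hobs_one_eq_prob' hg ho hadj hst he]
  exact ⟨fobs_eq' hg ho hadj hst he, hobs_zero_add_hobs_one' hg ho hadj hst he⟩

end Three

end Literature.Probability.Percolation.MarkedLoops
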